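import Summits.QuantumFields.YangMills.Theses.LangevinControlUV
import Summits.QuantumFields.YangMills.Theorems.HypercubicLimit.Negative.NonTrivialityBridge
import Literature.MathematicalPhysics.QuantumLattice.LatticeGaugeDLRGibbsProofs

/-!
# Route `LangevinControlUV`, crux `OSLegsFromFemtoAndGap` (stmt-QuantumFields-9367): vocabulary of line `dlr-collar-transfer`

Route-posited objects (D-0016 `<Route><Crux>Defs` file) shared by the registered stubs of the skeleton
`Cruxes/OSLegsFromFemtoAndGap/Lines/dlr_collar_transfer.lean` (planner `planner-cruxplan-stmt-QuantumFields-9367-dlr-collar-transfer-0`,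
lead `prover-line-stmt-QuantumFields-9367-0`) and by the crux work file composing them; VERBATIM the skeleton's
declarations (same namespace `Summit.QuantumFields.YangMills.Cruxes.OSLegsFromFemtoAndGap.DlrCollarTransfer`, so the
registered signatures `stub_pin : Statement.stub_pin`, …, `stub_assembly : Statement.stub_assembly` are unchanged).
NOTHING here is asserted: every `def … : Prop` is either a verbatim piece of the crux (`TwoPoint`, `Skewness`,
`GapInUnits`, `Concl`; `crux_iff` is `Iff.rfl`) or a line statement some registered stub proves or consumes (none is a
literature fact, none restates the crux as a claim).

* §0 the crux uncurried: H1 `TwoPoint`, H2 `Skewness`, H3 `GapInUnits`, `Concl`, `crux_iff`.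
* §1 the line's intermediate predicates over tree objects: `TwoPointPinned` (H1 with interval-positive shape function),
  cubes of `ℤ⁴` (`cubeSites`, `cubeEdges`, `depth`), the action density at a site (`dens`), the cube kernel of the tree
  specification `ymSpecification` (`kerE`, `kerCov`, `kerK3`), the frozen-boundary femto package `FBL`, `FC2`, `FC3`,
  large-torus quantities (`torusE`, `torusK3`, `Q2`, `Q3`), the collar outputs `MomentBounds`, `LowerBounds`, and the
  hypercubic pre-OS bundle `PreOS`.
* §2 the five line-internal stub statements `Statement.stub_pin`, `Statement.stub_fcp`, `Statement.stub_collar`,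
  `Statement.stub_lower`, `Statement.stub_assembly` (the two remaining stubs of the skeleton are the route items
  `CoincidenceRotationBootstrap.CurvatureAmnesia` (stmt-QuantumFields-8645) and `.EuclideanUpgrade` (stmt-QuantumFields-8647),
  taken by name).

Refs: line card `Cruxes/OSLegsFromFemtoAndGap/Lines/dlr-collar-transfer.md`; Disproof `Cruxes/OSLegsFromFemtoAndGap/Disproof.lean`
(v4); OsterwalderSchrader1975 §2; OsterwalderSeiler1978 §§2–3; GlimmJaffe1987 §6.1, §19; Georgii2011 Def. 2.9 / Thm. 4.17
(DLR kernels); JaffeWitten2000 §6.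
-/

set_option autoImplicit false

noncomputable section

open scoped SchwartzMap
open MeasureTheory Filter Topology
open Literature.MathematicalPhysics.QuantumFieldTheory Literature.MathematicalPhysics.QuantumLattice
open Literature.MathematicalPhysics.AQFT Literature.Probability.LatticeModels
open Summit.QuantumFields.YangMills.Theses.LangevinControlUV (OSLegsFromFemtoAndGap)

namespace Summit.QuantumFields.YangMills.Cruxes.OSLegsFromFemtoAndGap.DlrCollarTransfer

/-! ## §0 The crux, uncurried (verbatim bodies of the route decl; cf. Disproof §0) -/

section Anatomy

variable (G : Type) [Group G] [TopologicalSpace G] [IsTopologicalGroup G] [CompactSpace G]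
  [MeasurableSpace G] [BorelSpace G] (r : LatticeRep G) (a : ℝ → ℝ)

/-- H1, the femto two-point package of `FemtoCurvatureTwoPoint` for the unit map `a` (verbatim). -/
def TwoPoint : Prop :=
  ∃ (Γ : ℝ → ℝ) (β₀ ℓ₀ c C : ℝ), 0 < ℓ₀ ∧ 0 < c ∧ (∀ β, 0 < a β) ∧ Filter.Tendsto a Filter.atTop (nhds 0) ∧ (∀ s : ℝ, 0 < s → s ≤ ℓ₀ → 0 < Γ s ∧ Γ s ≤ 1) ∧ ∀ (L : ℕ) [NeZero L] (β : ℝ), β₀ ≤ β → (L : ℝ) * a β ≤ ℓ₀ → let P : (Fin 4 → ZMod L) → Fin 4 → Fin 4 → GaugeConfig 4 L G → ℝ := fun x i j U => (r.N : ℝ) - (r.ρ (plaquetteHolonomy U x i j)).trace.re; let E : (GaugeConfig 4 L G → ℝ) → ℝ := fun F => wilsonExpectation (d := 4) (L := L) r.ρ β F; let cov : (GaugeConfig 4 L G → ℝ) → (GaugeConfig 4 L G → ℝ) → ℝ := fun F F' => E (fun U => F U * F' U) - E F * E F'; let dist : (Fin 4 → ZMod L) → (Fin 4 → ZMod L) →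 ℝ := fun x y => Real.sqrt (∑ k : Fin 4, (((x k - y k).valMinAbs : ℤ) : ℝ) ^ 2); (∀ n : ℕ, 1 ≤ n → 8 * n ≤ L → c * Γ ((n : ℝ) * a β) ≤ (n : ℝ) ^ 8 * cov (P 0 0 1) (P (Pi.single (2 : Fin 4) ((n : ℕ) : ZMod L)) 0 1) ∧ (n : ℝ) ^ 8 * cov (P 0 0 1) (P (Pi.single (2 : Fin 4) ((n : ℕ) : ZMod L)) 0 1) ≤ C * Γ ((n : ℝ) * a β)) ∧ (∀ (x y : Fin 4 → ZMod L) (i j i' j' : Fin 4), x ≠ y → i ≠ j → i' ≠ j' → |cov (P x i j) (P y i' j')| * dist x y ^ 8 ≤ C * Γ (dist x y * a β))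

/-- H2, the femto skewness witness of `FemtoCurvatureSkewness` in units `a` (verbatim). -/
def Skewness : Prop :=
  ∃ (Γ₃ : ℝ → ℝ) (β₁ ℓ₁ c₃ : ℝ), 0 < ℓ₁ ∧ 0 < c₃ ∧ (∀ s : ℝ, 0 < s → s ≤ ℓ₁ → 0 < Γ₃ s) ∧ ∀ (L : ℕ) [NeZero L] (β : ℝ), β₁ ≤ β → (L : ℝ) * a β ≤ ℓ₁ → let P : (Fin 4 → ZMod L) → Fin 4 → Fin 4 → GaugeConfig 4 L G → ℝ := fun x i j U => (r.N : ℝ) - (r.ρ (plaquetteHolonomy U x i j)).trace.re; let E : (GaugeConfig 4 L G → ℝ) → ℝ := fun F => wilsonExpectation (d := 4) (L := L) r.ρ β F; let cov : (GaugeConfig 4 L G → ℝ) → (GaugeConfig 4 L G → ℝ) → ℝ := fun F F' => E (fun U => F U * F' U) - E F * E F'; ∀ n : ℕ, 1 ≤ n → 8 * n ≤ L → c₃ * Γ₃ ((n : ℝ) * a β) ≤ (n : ℝ) ^ 12 * |E (fun U => P 0 0 1 U * P (Pi.single (2 : Fin 4) ((n : ℕ) : ZMod L)) 0 1 U * P (Pi.single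 (3 : Fin 4) ((n : ℕ) : ZMod L)) 0 1 U) - E (P 0 0 1) * cov (P (Pi.single (2 : Fin 4) ((n : ℕ) : ZMod L)) 0 1) (P (Pi.single (3 : Fin 4) ((n : ℕ) : ZMod L)) 0 1) - E (P (Pi.single (2 : Fin 4) ((n : ℕ) : ZMod L)) 0 1) * cov (P 0 0 1) (P (Pi.single (3 : Fin 4) ((n : ℕ) : ZMod L)) 0 1) - E (P (Pi.single (3 : Fin 4) ((n : ℕ) : ZMod L)) 0 1) * cov (P 0 0 1) (P (Pi.single (2 : Fin 4) ((n : ℕ) : ZMod L)) 0 1) - E (P 0 0 1) * E (P (Pi.single (2 : Fin 4) ((n : ℕ) : ZMod L)) 0 1) * E (P (Pi.single (3 : Fin 4) ((n : ℕ) : ZMod L)) 0 1)|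

/-- H3, the lattice gap in units `a` of `LatticeGapInUVUnits` (verbatim). -/
def GapInUnits : Prop :=
  ∃ (c₁ β₂ : ℝ) (S₁ : ℝ → ℕ), 0 < c₁ ∧ ∀ A B : YMSpecies G, ∃ C : ℝ, ∀ β : ℝ, β₂ ≤ β → ∀ S n : ℕ, S₁ β ≤ S → n ≤ S → |latticeConnectedCorr r.ρ β (2 * S + 1) A.F B.F n| ≤ C * Real.exp (-(c₁ * a β * n))

/-- The conclusion of the crux for `(G, r, a)` (verbatim). -/
def Concl : Prop :=
  ∃ (sch : SpeciesScheme (YMSpecies G)) (T : OSData (YMSpecies G) 4), (∀ k, sch.a k = a (sch.β k)) ∧ IsYangMillsFor r sch T ∧ T.IsNontrivial r.curvature ∧ T.IsNonGaussian r.curvature ∧ ∃ Δ > 0, HasLatticeMassGap r sch Δ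

end Anatomy

/-- §0. The crux uncurried: `H1 → H2 → H3 → Concl` for every compact simple `G`, every `r`, every unit map
`a` (definitional unfolding of the route decl). -/
theorem crux_iff : Summit.QuantumFields.YangMills.Theses.LangevinControlUV.OSLegsFromFemtoAndGap ↔ ∀ (G : Type) [Group G] [TopologicalSpace G] [IsTopologicalGroup G] [CompactSpace G], Literature.MathematicalPhysics.QuantumFieldTheory.IsCompactSimpleLieGroup G → letI : MeasurableSpace G := borel G; haveI : BorelSpace G := ⟨rfl⟩; ∀ (r : Literature.MathematicalPhysics.QuantumFieldTheory.LatticeRep G) (a : ℝ → ℝ), TwoPoint G r a → Skewness G r a → GapInUnits G r a → Concl G r a :=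
  Iff.rfl

/-! ## §1 Intermediate predicates of the line (definitional bookkeeping over tree objects; nothing posited) -/

section Predicates

variable (G : Type) [Group G] [TopologicalSpace G] [IsTopologicalGroup G] [CompactSpace G]
  [MeasurableSpace G] [BorelSpace G] (r : LatticeRep G) (a : ℝ → ℝ)

/-- **H1 pinned** (`TwoPointPinned`): the femto two-point package H1 with a shape function that is bounded
below on every compact sub-interval `[s₁, s₂] ⊆ (0, ℓ₀/8]` (the range the axis clause probes: `n ≤ L/8`,
`L a ≤ ℓ₀`) — the one extra clause that excludes the fake (fast-decaying, incommensurable-plateau) unit maps of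
Disproof §6 / triage X1.  Under `Continuous a` it follows from H1 alone (IVT + compactness + continuity of
`β ↦ wilsonExpectation`: triager-2's PROVED `IntervalPinning`, same hypothesis `8 s₂ ≤ ℓ₀`). -/
def TwoPointPinned : Prop :=
  ∃ (Γ : ℝ → ℝ) (β₀ ℓ₀ c C : ℝ), 0 < ℓ₀ ∧ 0 < c ∧ (∀ β, 0 < a β) ∧ Filter.Tendsto a Filter.atTop (nhds 0) ∧ (∀ s : ℝ, 0 < s → s ≤ ℓ₀ → 0 < Γ s ∧ Γ s ≤ 1) ∧ (∀ s₁ s₂ : ℝ, 0 < s₁ → s₁ ≤ s₂ → 8 * s₂ ≤ ℓ₀ → ∃ m : ℝ, 0 < m ∧ ∀ s : ℝ, s₁ ≤ s → s ≤ s₂ → m ≤ Γ s) ∧ ∀ (L : ℕ) [NeZero L] (β : ℝ), β₀ ≤ β → (L : ℝ) * a β ≤ ℓ₀ → let P : (Fin 4 → ZMod L) → Fin 4 → Fin 4 → GaugeConfig 4 L G → ℝ := fun x i j U => (r.N : ℝ) - (r.ρ (plaquetteHolonomy U x i j)).trace.re; let E : (GaugeConfig 4 L G → ℝ) → ℝ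 := fun F => wilsonExpectation (d := 4) (L := L) r.ρ β F; let cov : (GaugeConfig 4 L G → ℝ) → (GaugeConfig 4 L G → ℝ) → ℝ := fun F F' => E (fun U => F U * F' U) - E F * E F'; let dist : (Fin 4 → ZMod L) → (Fin 4 → ZMod L) → ℝ := fun x y => Real.sqrt (∑ k : Fin 4, (((x k - y k).valMinAbs : ℤ) : ℝ) ^ 2); (∀ n : ℕ, 1 ≤ n → 8 * n ≤ L → c * Γ ((n : ℝ) * a β) ≤ (n : ℝ) ^ 8 * cov (P 0 0 1) (P (Pi.single (2 : Fin 4) ((n : ℕ) : ZMod L)) 0 1) ∧ (n : ℝ) ^ 8 * cov (P 0 0 1) (P (Pi.single (2 : Fin 4) ((n : ℕ) : ZMod L)) 0 1) ≤ C * Γ ((n : ℝ) * a β)) ∧ (∀ (x y : Fin 4 → ZMod L) (i j i' j' : Fin 4), x ≠ y → i ≠ j → i' ≠ j' → |cov (P x i j) (P y i' j')| * dist x y ^ 8 ≤ C * Γ (dist x y * a β))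

/-! ### Cubes of `ℤ⁴`, their interior links, depth; the action density at a site -/

/-- Sites of the axis-parallel cube of side `b` based at `c`: `∏ⱼ [c j, c j + b)`. -/
def cubeSites (c : Fin 4 → ℤ) (b : ℕ) : Finset (Fin 4 → ℤ) :=
  Fintype.piFinset fun j => Finset.Ico (c j) (c j + b)

/-- Interior (positively oriented) links of the cube: both endpoints are cube sites.  Conditioning on the
links OUTSIDE this set is conditioning on the exterior of the cube (the DLR volume `Λ`). -/
def cubeEdges (c : Fin 4 → ℤ) (b : ℕ) : Finset (Literature.MathematicalPhysics.QuantumLattice.ZdEdge 4) :=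
  ((cubeSites c b) ×ˢ (Finset.univ : Finset (Fin 4))).filter fun e => e.1 + Pi.single e.2 1 ∈ cubeSites c b

/-- Depth of a site in the cube `(c, b)`: sup-norm distance to the complement, `0` outside. -/
def depth (c : Fin 4 → ℤ) (b : ℕ) (x : Fin 4 → ℤ) : ℕ :=
  Finset.univ.inf' Finset.univ_nonempty fun j : Fin 4 => min (x j - c j + 1).toNat (c j + b - x j).toNat

/-- The action density (the curvature species `r.curvature`, i.e. `Σ_{i<j} Re tr r(U_p)` over the six
plaquettes based at the site) translated to the site `x` of `ℤ⁴` — the observable the conclusion's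
`IsNontrivial`/`IsNonGaussian` clauses and `smearedLatticeField` see. -/
def dens (x : Fin 4 → ℤ) (U : LGConfig 4 G) : ℝ :=
  r.curvature.F (configShift (-x) U)

/-- Expectation under the lattice Yang–Mills kernel of the cube `(c, b)` with exterior (boundary condition)
`η` at inverse coupling `β` (tree `ymSpecification`). -/
def kerE (β : ℝ) (c : Fin 4 → ℤ) (b : ℕ) (η : LGConfig 4 G) (F : LGConfig 4 G → ℝ) : ℝ :=
  ∫ U, F U ∂(ymSpecification (d := 4) r.ρ β (cubeEdges c b) η)

/-- Conditional covariance of two observables under the cube kernel with exterior `η`. -/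
def kerCov (β : ℝ) (c : Fin 4 → ℤ) (b : ℕ) (η : LGConfig 4 G) (F F' : LGConfig 4 G → ℝ) : ℝ :=
  kerE G r β c b η (fun U => F U * F' U) - kerE G r β c b η F * kerE G r β c b η F'

/-- Conditional third cumulant of the action densities at `x, y, z` under the cube kernel with exterior `η`
(the combination of `OSData.IsNonGaussian`). -/
def kerK3 (β : ℝ) (c : Fin 4 → ℤ) (b : ℕ) (η : LGConfig 4 G) (x y z : Fin 4 → ℤ) : ℝ :=
  kerE G r β c b η (fun U => dens G r x U * dens G r y U * dens G r z U)
    - kerE G r β c b η (dens G r x) * kerE G r β c b η (fun U => dens G r y U * dens G r z U)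
    - kerE G r β c b η (dens G r y) * kerE G r β c b η (fun U => dens G r x U * dens G r z U)
    - kerE G r β c b η (dens G r z) * kerE G r β c b η (fun U => dens G r x U * dens G r y U)
    + 2 * (kerE G r β c b η (dens G r x) * kerE G r β c b η (dens G r y) * kerE G r β c b η (dens G r z))

/-! ### The frozen-boundary femto package FCP = FBL ∧ FC2 ∧ FC3 (the line's hypothesis-side object) -/

/-- **FBL — femto boundary law.**  On every femto cube (`b · a(β) ≤ ℓ₁`), for EVERY exterior configuration
`η`, the kernel mean of the action density at a site of depth `d ≥ 2` is within `C₁/d⁴` of a reference value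
`p β`: a boundary can force only `O(1)` flux through the cube (compactness and non-abelianness of `G`), which
spreads as curvature `O(d⁻²)`, i.e. shifts `⟨tr F²⟩` by `O(d⁻⁴)` = the scaling dimension of `tr F²`.
(Triager 2's uniform-flux attack: `d⁻⁴` survives for non-abelian `G`; kit j012977 cooling profiles follow `d⁻⁴`.) -/
def FBL : Prop :=
  ∃ (C₁ β₁ ℓ₁ : ℝ) (p : ℝ → ℝ), 0 < ℓ₁ ∧ 0 ≤ C₁ ∧ ∀ β : ℝ, β₁ ≤ β → ∀ (c : Fin 4 → ℤ) (b : ℕ), (b : ℝ) * a β ≤ ℓ₁ → ∀ (η : LGConfig 4 G) (x : Fin 4 → ℤ), 2 ≤ depth c b x → |kerE G r β c b η (dens G r x) - p β| ≤ C₁ / (depth c b x : ℝ) ^ 4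

/-- **FC2 — two-sided conditional two-point bounds for the action density, all directions, interval-positive
continuous shape, scale-indexed collar depth.**  For every exterior `η`, deep inside femto cubes — depths
`≥ K(s₀)·|y−x|` for pairs at physical separation `|y−x|·a(β) ≥ s₀` — the conditional covariance of the action
densities at `x, y` (`|y − x| ≥ n₀`) is sandwiched `c₂ Γ(|y−x| a) ≤ |y−x|⁸·CondCov ≤ C₂ Γ(|y−x| a)` with ONE
continuous `0 < Γ ≤ 1` on `(0, ℓ₂]` that is NOT `O(s⁸)` at `0⁺` (the card's clause; physically `Γ(s) ≍ g(s)⁴`;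
tree level `2 tr R_x²/π⁴ = 12/π⁴` in EVERY direction since `R_x² = 1`: isotropic, a sum of squares, no cone
needed for the scalar `tr F²` — triage X2).  The collar depth is a FUNCTION `K(s₀) ≥ 1` of the physical scale
with `s₀ K(s₀) → 0`: a worst-case exterior forces a saturated classical flux `B(d) ≍ d⁻²` (triager 2's funnel
cascade), whose linear-response contamination of the covariance is `≍ 1/(g(s₀)² K⁴)` relative, so no FIXED `K`
survives `s₀ → 0`, while `K(s₀) ≍ g(s₀)^{-1/2}` does and still fits in a femto cube.  The growth clauses are
exactly what lets `stub_lower` beat FBL's boundary term `(2C₁/d⁴)²` at an achievable depth for SOME `s`. -/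
def FC2 : Prop :=
  ∃ (Γ : ℝ → ℝ) (β₂ ℓ₂ c₂ C₂ : ℝ) (K : ℝ → ℝ) (n₀ : ℕ), 0 < ℓ₂ ∧ 0 < c₂ ∧ (∀ s, 1 ≤ K s) ∧ Filter.Tendsto (fun s : ℝ => s * K s) (nhdsWithin 0 (Set.Ioi 0)) (nhds 0) ∧ 1 ≤ n₀ ∧ ContinuousOn Γ (Set.Ioc 0 ℓ₂) ∧ (∀ s : ℝ, 0 < s → s ≤ ℓ₂ → 0 < Γ s ∧ Γ s ≤ 1) ∧ Filter.Tendsto (fun s : ℝ => Γ s / s ^ 8) (nhdsWithin 0 (Set.Ioi 0)) Filter.atTop ∧ ∀ β : ℝ, β₂ ≤ β → ∀ (c : Fin 4 → ℤ) (b : ℕ), (b : ℝ) * a β ≤ ℓ₂ → ∀ (η : LGConfig 4 G) (x y : Fin 4 → ℤ) (s₀ : ℝ), 0 < s₀ → s₀ ≤ ‖siteToE (y - x)‖ * a β → (n₀ : ℝ) ≤ ‖siteToE (y - x)‖ → K s₀ * ‖siteToE (y - x)‖ ≤ depth c b x → K s₀ * ‖siteToE (y - x)‖ ≤ depth c b y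 → c₂ * Γ (‖siteToE (y - x)‖ * a β) ≤ ‖siteToE (y - x)‖ ^ 8 * kerCov G r β c b η (dens G r x) (dens G r y) ∧ ‖siteToE (y - x)‖ ^ 8 * kerCov G r β c b η (dens G r x) (dens G r y) ≤ C₂ * Γ (‖siteToE (y - x)‖ * a β)

/-- **FC3 — signed conditional third cumulant at one reference shape.**  There are a reference triangle shape
(`y − x ≈ n v`, `z − x ≈ n w` up to `δ n`; the three `δ`-balls around `0, v, w` disjoint), a SIGN `σ = ±1`, a
continuous `Γ₃ > 0` on `(0, ℓ₃]` not `O(s⁴)` at `0⁺`, and a scale-indexed collar depth `K₃(s₀) ≥ 1` with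
`s₀ K₃(s₀) → 0`, such that for every exterior `η`, at depths `≥ K₃(s₀) n` (`n a(β) ≥ s₀`),
`σ · n¹² · κ₃^η(A_x, A_y, A_z) ≥ c₃ Γ₃(n a)`.  By the duality zero (module docstring) this is a ONE-LOOP statement
(`Γ₃ ≍ g⁸`): sign control of the `O(g²)`-relative term of `⟨tr F² tr F² tr F²⟩_conn` at the chosen shape,
uniformly over exteriors — the hardest clause of the package.  The growth clauses let `stub_lower` beat the mixed
terms `Cov(h, kerCov) ≲ C₁C₂Γ/(d⁴ν⁸)` and `κ₃(h,h,h) ≲ C₁³/d¹²` of the law of total cumulance. -/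
def FC3 : Prop :=
  ∃ (v w : EuclideanSpace ℝ (Fin 4)) (σ δ : ℝ) (Γ₃ : ℝ → ℝ) (β₃ ℓ₃ c₃ : ℝ) (K₃ : ℝ → ℝ) (n₃ : ℕ), (σ = 1 ∨ σ = -1) ∧ 0 < δ ∧ 2 * δ < ‖v‖ ∧ 2 * δ < ‖w‖ ∧ 2 * δ < ‖v - w‖ ∧ 0 < ℓ₃ ∧ 0 < c₃ ∧ (∀ s, 1 ≤ K₃ s) ∧ Filter.Tendsto (fun s : ℝ => s * K₃ s) (nhdsWithin 0 (Set.Ioi 0)) (nhds 0) ∧ 1 ≤ n₃ ∧ ContinuousOn Γ₃ (Set.Ioc 0 ℓ₃) ∧ (∀ s : ℝ, 0 < s → s ≤ ℓ₃ → 0 < Γ₃ s) ∧ Filter.Tendsto (fun s : ℝ => Γ₃ s / s ^ 4) (nhdsWithin 0 (Set.Ioi 0)) Filter.atTop ∧ ∀ β : ℝ, β₃ ≤ β → ∀ (c : Fin 4 → ℤ) (b : ℕ), (b : ℝ) * a β ≤ ℓ₃ → ∀ (η : LGConfig 4 G) (n : ℕ) (x y z : Fin 4 → ℤ) (s₀ :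 ℝ), 0 < s₀ → s₀ ≤ (n : ℝ) * a β → n₃ ≤ n → ‖siteToE (y - x) - (n : ℝ) • v‖ ≤ δ * n → ‖siteToE (z - x) - (n : ℝ) • w‖ ≤ δ * n → K₃ s₀ * n ≤ depth c b x → K₃ s₀ * n ≤ depth c b y → K₃ s₀ * n ≤ depth c b z → c₃ * Γ₃ ((n : ℝ) * a β) ≤ σ * (n : ℝ) ^ 12 * kerK3 G r β c b η x y z

/-! ### Large-torus quantities in units `a` (tori of side `2L+1`, periodic lift) -/

/-- Expectation of an observable of the periodic lift under Wilson's measure on the torus of side `2L+1`. -/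
def torusE (β : ℝ) (L : ℕ) (F : LGConfig 4 G → ℝ) : ℝ :=
  ∫ U, F (torusLift (2 * L + 1) U) ∂(wilsonMeasure (d := 4) (L := 2 * L + 1) r.ρ β)

/-- Torus third cumulant of the action densities at `x, y, z` (the `IsNonGaussian` combination). -/
def torusK3 (β : ℝ) (L : ℕ) (x y z : Fin 4 → ℤ) : ℝ :=
  torusE G r β L (fun U => dens G r x U * dens G r y U * dens G r z U)
    - torusE G r β L (dens G r x) * torusE G r β L (fun U => dens G r y U * dens G r z U)
    - torusE G r β L (dens G r y) * torusE G r β L (fun U => dens G r x U * dens G r z U)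
    - torusE G r β L (dens G r z) * torusE G r β L (fun U => dens G r x U * dens G r y U)
    + 2 * (torusE G r β L (dens G r x) * torusE G r β L (dens G r y) * torusE G r β L (dens G r z))

/-- Bare smeared truncated two-point function at spacing `s` on the torus of side `2L+1`:
`Σ_{x,y ∈ box L} f(s x) g(s y) Cov(A_x, A_y)` — equal to the truncated lattice two-point function of
`latticeSchwinger` for the curvature species with `c = s⁻⁴` (any counterterm `m`). -/
def Q2 (β : ℝ) (L : ℕ) (s : ℝ) (f g : 𝓢(EuclideanSpace ℝ (Fin 4), ℝ)) : ℝ :=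
  ∑ x ∈ box 4 L, ∑ y ∈ box 4 L, f (s • siteToE x) * g (s • siteToE y) *
    (torusE G r β L (fun U => dens G r x U * dens G r y U) - torusE G r β L (dens G r x) * torusE G r β L (dens G r y))

/-- Bare smeared connected three-point function at spacing `s` on the torus of side `2L+1` (with `c = s⁻⁴`
it is the `IsNonGaussian` combination of the lattice Schwinger functions, any `m`). -/
def Q3 (β : ℝ) (L : ℕ) (s : ℝ) (f g h : 𝓢(EuclideanSpace ℝ (Fin 4), ℝ)) : ℝ :=
  ∑ x ∈ box 4 L, ∑ y ∈ box 4 L, ∑ z ∈ box 4 L, f (s • siteToE x) * g (s • siteToE y) * h (s • siteToE z) *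
    torusK3 G r β L x y z

/-- **MomentBounds — the collar output (hyperscaling `a⁴` per insertion on EVERY torus).**  For `β ≥ β₄`, any
odd torus, any `n` sites whose pairwise torus sup-distance is `≥ 2R+4` (`1 ≤ R`, `R a(β) ≤ ℓ₄`, `4R+8 ≤ L`),
the centred `n`-th moment of the action densities is at most `(C/R⁴)ⁿ`: disjoint cubes of radius `R+1`,
conditional independence given the exterior (torus DLR, tree), FBL inside each cube. -/
def MomentBounds : Prop :=
  ∃ (C β₄ ℓ₄ : ℝ), 0 < ℓ₄ ∧ 0 ≤ C ∧ ∀ β : ℝ, β₄ ≤ β → ∀ (L n : ℕ) (x : Fin n → (Fin 4 → ℤ)) (R : ℕ), 1 ≤ R → (R : ℝ) * a β ≤ ℓ₄ → 4 * R + 8 ≤ L → (∀ i j : Fin n, i ≠ j → ∃ k : Fin 4, (2 * (R : ℤ) + 4) ≤ |((((x i k - x j k : ℤ) : ZMod (2 * L + 1))).valMinAbs : ℤ)|) → |torusE G r β L (fun U => ∏ i, (dens G r (x i) U - torusE G r β L (dens G r (x i))))| ≤ (C / (R : ℝ) ^ 4) ^ n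

/-- **LowerBounds — the non-triviality inputs in lattice form, k-free.**  (i) one real positive-time `v`
with `Q2(θv, v) ≥ ε > 0` on every large torus at every large `β` (the exact form
`Theorems.HypercubicLimit.Negative.twoPointNontrivial_iff_lattice_diagonal` consumes); (ii) three real test
functions with pairwise disjoint supports and `|Q3(f,g,h)| ≥ ε` likewise. -/
def LowerBounds : Prop :=
  (∃ (v : 𝓢(EuclideanSpace ℝ (Fin 4), ℝ)) (ε β₅ Λ₅ : ℝ), tsupport v ⊆ {y : EuclideanSpace ℝ (Fin 4) | 0 < y 0} ∧ 0 < ε ∧ ∀ β : ℝ, β₅ ≤ β → ∀ L : ℕ, Λ₅ ≤ a β * L → ε ≤ Q2 G r β L (a β) (thetaTest 4 v) v) ∧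
  (∃ (f g h : 𝓢(EuclideanSpace ℝ (Fin 4), ℝ)) (ε β₅ Λ₅ : ℝ), Disjoint (tsupport f) (tsupport g) ∧ Disjoint (tsupport g) (tsupport h) ∧ Disjoint (tsupport f) (tsupport h) ∧ 0 < ε ∧ ∀ β : ℝ, β₅ ≤ β → ∀ L : ℕ, Λ₅ ≤ a β * L → ε ≤ |Q3 G r β L (a β) f g h|)

/-- **PreOS — everything but the rotation half of E1, for a scheme in units `a`.**  `∃ sch S`: the units
clause, the clause bundle of `CoincidenceRotationBootstrap.HypercubicLimit` VERBATIM (E0, E0′, E2, E3, E4,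
translations, proper-hypercubic invariance; the `IsYangMillsFor` body; the `IsNontrivial` and `IsNonGaussian`
bodies for `r.curvature`; `S.HasMassGap Δ ∧ HasLatticeMassGap r sch Δ`), and the curvature-only clause (every
other species renormalised to zero, `onlySpecies`; renormalisations are witness data, Disproof §7). -/
def PreOS : Prop :=
  let E := EuclideanSpace ℝ (Fin 4); ∃ (sch : SpeciesScheme (YMSpecies G)) (S : LabelledSchwingerFamily (YMSpecies G) (E)), (∀ k, sch.a k = a (sch.β k)) ∧ ((S.IsNormalized ∧ S.IsHermitian ∧ S.HasLinearGrowth ∧ S.IsReflectionPositive ∧ S.IsSymmetric ∧ S.HasClusterProperty ∧ (∀ (n : ℕ) (k : Fin n → YMSpecies G) (a : E) (F : SchwartzMap (Fin n → E) ℂ), IsOffDiagonal F → S n k (translateMulti a F) = S n k F) ∧ (∀ (n : ℕ) (k : Fin n → YMSpecies G) (R : E ≃ₗᵢ[ℝ] E), LinearMap.det (R.toLinearEquiv : E →ₗ[ℝ] E) = 1 → (∀ i : Fin 4, ∃ j : Fin 4, R (EuclideanSpace.single i 1) = EuclideanSpace.single j 1 ∨ R (EuclideanSpace.single i 1) = -EuclideanSpace.single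 j 1) → ∀ F : SchwartzMap (Fin n → E) ℂ, IsOffDiagonal F → S n k (linActMulti R F) = S n k F)) ∧ (∀ (n : ℕ), n ≠ 0 → ∀ (σ : Fin n → YMSpecies G) (f : Fin n → SchwartzMap (E) ℝ) (F : SchwartzMap (Fin n → E) ℂ), IsTensorOf F (fun i => ofRealTest (f i)) → IsOffDiagonal F → Filter.Tendsto (fun k : ℕ => ((latticeSchwinger r.ρ sch (fun s => s.F) k n σ f : ℝ) : ℂ)) Filter.atTop (nhds (S n σ F))) ∧ (∃ (F₁ G₁ : SchwartzMap (Fin 1 → E) ℂ) (H₁ : SchwartzMap (Fin (1 + 1) → E) ℂ), IsTimeOrdered F₁ ∧ IsTimeOrdered G₁ ∧ IsAppendTensorOf H₁ (osAdjoint F₁) G₁ ∧ S (1 + 1) (fun _ => r.curvature) H₁ ≠ S 1 (fun _ => r.curvature) (osAdjoint F₁) * S 1 (fun _ => r.curvature) G₁) ∧ (∃ (f g h : SchwartzMap (E) ℂ) (Ffgh : SchwartzMap (Fin 3 → E) ℂ) (Fgh Ffh Ffg : SchwartzMap (Fin 2 → E) ℂ) (Ff Fg Fh : SchwartzMap (Fin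 1 → E) ℂ), IsTensorOf Ffgh ![f, g, h] ∧ IsOffDiagonal Ffgh ∧ IsTensorOf Fgh ![g, h] ∧ IsTensorOf Ffh ![f, h] ∧ IsTensorOf Ffg ![f, g] ∧ IsTensorOf Ff ![f] ∧ IsTensorOf Fg ![g] ∧ IsTensorOf Fh ![h] ∧ S 3 (fun _ => r.curvature) Ffgh - S 1 (fun _ => r.curvature) Ff * S 2 (fun _ => r.curvature) Fgh - S 1 (fun _ => r.curvature) Fg * S 2 (fun _ => r.curvature) Ffh - S 1 (fun _ => r.curvature) Fh * S 2 (fun _ => r.curvature) Ffg + 2 * (S 1 (fun _ => r.curvature) Ff * S 1 (fun _ => r.curvature) Fg * S 1 (fun _ => r.curvature) Fh) ≠ 0) ∧ (∃ Δ : ℝ, 0 < Δ ∧ S.HasMassGap Δ ∧ HasLatticeMassGap r sch Δ)) ∧ (∀ (n : ℕ) (k : Fin n → YMSpecies G) (F : SchwartzMap (Fin n → E) ℂ), (∃ i, k i ≠ r.curvature) → S n k F = 0)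

end Predicates

/-! ## §2 The registered stubs -/

/-- **UnitPinning — statement of `stub_pin` (`Statement.stub_pin`) — the typed-crux residue (triage X1/C1, Disproof §6/§8), isolated.**  H1 ∧ H3 ⇒ H1 with an
interval-positive shape function.  As typed (`a` arbitrary) this is exactly as doubtful as the crux itself
(fake unit maps with incommensurable plateaux meet H1/H3 physically while the interval infimum fails) and
formally undecidable today (a refutation needs an H1 ∧ H3 witness = the lattice gap at all weak couplings,
Disproof §1); under the tenure repair R1′ (`Continuous a`) it is triager-2's PROVED `IntervalPinning`
(IVT + compactness + continuity of `β ↦ wilsonExpectation`), under R2 it follows from the lower clustering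
clause.  NOT to be staffed before the repair ruling. -/
def Statement.stub_pin : Prop :=
  ∀ (G : Type) [Group G] [TopologicalSpace G] [IsTopologicalGroup G] [CompactSpace G]
    [MeasurableSpace G] [BorelSpace G], IsCompactSimpleLieGroup G →
    ∀ (r : LatticeRep G) (a : ℝ → ℝ), TwoPoint G r a → GapInUnits G r a → TwoPointPinned G r a

/-- **ConditionalFemtoPackage — statement of `stub_fcp` (`Statement.stub_fcp`) — the frozen-boundary femto package (ENGINE-GRADE; Disproof §5's "genuine extra input").**
For a pinned unit map, the periodic femto packages H1⁺ ∧ H2 upgrade to the conditional package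
FBL ∧ FC2 ∧ FC3 for the action density on femto CUBES with frozen exterior links, uniformly in the exterior.
No soft argument turns periodic into conditional data (no Griffiths/FKG for non-abelian `G`); the intended
proof is the UV engine run with frozen links (the SZZ/Boué–Dupuis dynamics on fewer coordinates has the kernel
`ymSpecification` as invariant law; Bałaban-type engines carry background fields natively) — which is why the
card asks tenure to move FCP into 9363⁺/9365⁺.  FC3 is one-loop (duality zero). -/
def Statement.stub_fcp : Prop :=
  ∀ (G : Type) [Group G] [TopologicalSpace G] [IsTopologicalGroup G] [CompactSpace G]
    [MeasurableSpace G] [BorelSpace G], IsCompactSimpleLieGroup G →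
    ∀ (r : LatticeRep G) (a : ℝ → ℝ), TwoPointPinned G r a → Skewness G r a →
      FBL G r a ∧ FC2 G r a ∧ FC3 G r a

/-- **CollarTransfer — statement of `stub_collar` (`Statement.stub_collar`) — the lever: FBL ⇒ `(C/R⁴)ⁿ` centred-moment bounds on every torus.**  Torus DLR equation
(tree `wilsonExpectation_toTorusObservable_eq`) for the union `Λ = ⋃ᵢ cubeEdges` of the radius-`R+1` cubes
around the sites; the kernel of a union of mutually non-adjacent cubes is the product of the cube kernels
(finite range of the Wilson interaction: no plaquette touches two cubes at sup-distance `≥ 2R+4`); so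
`E[∏(Aᵢ − EAᵢ)] = E[∏ hᵢ]` with `hᵢ = kerE(Aᵢ) − EAᵢ`, and `‖hᵢ‖_∞ ≤ 2C₁/R⁴`-type bounds from FBL (the torus
mean is itself an average of kernel means).  Size M; provable now given FBL. -/
def Statement.stub_collar : Prop :=
  ∀ (G : Type) [Group G] [TopologicalSpace G] [IsTopologicalGroup G] [CompactSpace G]
    [MeasurableSpace G] [BorelSpace G] (r : LatticeRep G) (a : ℝ → ℝ),
    FBL G r a → MomentBounds G r a

/-- **CollarLowerBounds — statement of `stub_lower` (`Statement.stub_lower`) — femto conditional lower bounds ⇒ k-free lattice lower bounds on large tori.**  Law of total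
covariance / cumulance w.r.t. the exterior of ONE femto cube containing the two (three) insertion regions:
`Cov = E[kerCov] + Cov(h, h)` with `|h| ≤ 2C₁/d⁴` (FBL) and `kerCov ≥ c₂Γ/ν⁸` (FC2), depth `d ≥ K'ν` chosen
so that the boundary term is half the signal (interval infimum of the continuous `Γ` on `[s₁, s₂]`); test
functions: `v ≥ 0` a bump at height `s/2` above the time-zero plane (all pair directions then lie in a cone,
all separations in `[s₁, s₂]`), `f, g, h ≥ 0` bumps at `0, s v⃗, s w⃗` of radius `δ s/2` (FC3's shape), Riemann
sums `Σ a⁴ v(a x) → ∫ v > 0` as `a → 0`; the κ₃ transfer also uses FC2's UPPER bound (mixed terms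
`Cov(h, kerCov)`).  Size M/L; provable now given the package. -/
def Statement.stub_lower : Prop :=
  ∀ (G : Type) [Group G] [TopologicalSpace G] [IsTopologicalGroup G] [CompactSpace G]
    [MeasurableSpace G] [BorelSpace G] (r : LatticeRep G) (a : ℝ → ℝ),
    (∀ β, 0 < a β) → Filter.Tendsto a Filter.atTop (nhds 0) →
      FBL G r a → FC2 G r a → FC3 G r a → LowerBounds G r a

/-- **HypercubicAssembly — statement of `stub_assembly` (`Statement.stub_assembly`) — the soft OS legs (everything but rotations) from the three lattice inputs.**
Scheme: `β_k → ∞`, `a_k = a(β_k)`, `c_curv(k) = a_k⁻⁴`, `m_curv(k)` = torus mean, other species zeroed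
(`onlySpecies`), `L_k ≥ S₁(β_k)` with `a_k L_k → ∞` and SHADOWING an infinite-volume limit state `ω_{β_k}` on the
first `k` members of a countable dense test family (ruling Y2: existence, `∃ sch`); E0′ + k-uniform bounds on
`⁰𝒮` from `MomentBounds` + boundedness (Hadamard lemma against `schwartzNorm`), diagonal subsequence +
equicontinuity ⇒ the `IsYangMillsFor` body; E0, E2 (odd-torus RP, tree `wilsonExpectation_oddReflectionPositive`),
E3, translations, proper-hypercubic invariance inherited; `HasLatticeMassGap` by the landed re-indexing lemma
`Negative.UnitsAndGapFree.hasLatticeMassGap_of_gapInUnits`; `S.HasMassGap c₁` (hence E4) by the RP pair→norm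
upgrade of H3 in `ω_β` (`PairToNormClustering` / PROVED `selfImprovingDecay`, cards cold-torus /
rp-self-improving) + shadowing; non-triviality and non-Gaussianity from `LowerBounds` via
`Theorems.HypercubicLimit.Negative.twoPointNontrivial_of_real`.  Size XL but no open problem inside. -/
def Statement.stub_assembly : Prop :=
  ∀ (G : Type) [Group G] [TopologicalSpace G] [IsTopologicalGroup G] [CompactSpace G]
    [MeasurableSpace G] [BorelSpace G] (r : LatticeRep G) (a : ℝ → ℝ),
    (∀ β, 0 < a β) → Filter.Tendsto a Filter.atTop (nhds 0) →
      MomentBounds G r a → LowerBounds G r a → GapInUnits G r a → PreOS G r a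

/-! ## §3 Plane-resolved collar data (lead's reshape, cycle 2)

The action density is corner-based: `r.curvature.F = Σ_{i<j} plaquetteObs r.ρ 0 i j`.  A lattice reflection in
direction `μ` maps `dens x` to `Σ_{p ∌ μ} P^p_{θx} + Σ_{p ∋ μ} P^p_{θx − e_μ}` — the three planes containing `μ`
hang one lattice unit below the other three (tree: `HypercubicLimit.Negative.torusDensity_timeReflect`,
`reflDensity_sub_torusDensity`).  Hence the lattice OS form, lattice hermiticity and the reflection half of the
hypercubic clause pair the smeared density with a DIFFERENT local field at the lattice scale, and every
reflection-positivity argument about the limit (E2, E0-hermiticity, signed permutations, the E4/mass-gap rope)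
needs `a`-uniform bounds on correlations MIXING the density with single-plane fields — which centred-moment
bounds for `dens` alone (`MomentBounds`) do not supply (the composite field has `‖Φ(f)‖₂ ~ a⁻²`, so no `L²`
shortcut).  The plane-resolved data below repair this inside the line: `FBL6` is `FBL` per plaquette
orientation (the femto two-point hypothesis H1 is itself single-plane), `MomentBounds6` the corresponding collar
output for plane strings; `MomentBounds6 ⇒ MomentBounds` and `FBL6 ⇒ FBL` by expanding `dens = Σ_p P^p`.
Within the plane family reflections act EXACTLY up to per-argument lattice shifts, which equicontinuity absorbs. -/

section PlaneResolved

variable (G : Type) [Group G] [TopologicalSpace G] [IsTopologicalGroup G] [CompactSpace G]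
  [MeasurableSpace G] [BorelSpace G] (r : LatticeRep G) (a : ℝ → ℝ)

/-- The single-plane plaquette field `Re tr r.ρ(U_p)` of orientation `q = (i, j)` based at the site `x` of `ℤ⁴`
(so that `dens x = Σ_{i<j} plane (i, j) x`, see `dens_eq_sum_plane`). -/
def plane (q : Fin 4 × Fin 4) (x : Fin 4 → ℤ) (U : LGConfig 4 G) : ℝ :=
  plaquetteObs r.ρ 0 q.1 q.2 (configShift (-x) U)

/-- **FBL6 — plane-resolved femto boundary law.**  On every femto cube (`b · a(β) ≤ ℓ₁`), for every exterior
`η` and every orientation `i < j`, the kernel mean of the single-plane plaquette field at a site of depth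
`d ≥ 2` is within `C₁/d⁴` of a reference value `p (i, j) β` (the same mechanism as `FBL`, one orientation at a
time). -/
def FBL6 : Prop :=
  ∃ (C₁ β₁ ℓ₁ : ℝ) (p : Fin 4 × Fin 4 → ℝ → ℝ), 0 < ℓ₁ ∧ 0 ≤ C₁ ∧ ∀ β : ℝ, β₁ ≤ β →
    ∀ (c : Fin 4 → ℤ) (b : ℕ), (b : ℝ) * a β ≤ ℓ₁ → ∀ (η : LGConfig 4 G) (q : Fin 4 × Fin 4) (x : Fin 4 → ℤ),
      q.1 < q.2 → 2 ≤ depth c b x → |kerE G r β c b η (plane G r q x) - p q β| ≤ C₁ / (depth c b x : ℝ) ^ 4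

/-- **MomentBounds6 — plane-resolved collar output.**  For `β ≥ β₄`, any odd torus, any string of orientations
`q i = (i₁ < i₂)` at `n` sites whose pairwise torus sup-distance is `≥ 2R+4` (`1 ≤ R`, `R a(β) ≤ ℓ₄`,
`4R+8 ≤ L`), the centred mixed moment of the single-plane fields is at most `(C/R⁴)ⁿ`. -/
def MomentBounds6 : Prop :=
  ∃ (C β₄ ℓ₄ : ℝ), 0 < ℓ₄ ∧ 0 ≤ C ∧ ∀ β : ℝ, β₄ ≤ β →
    ∀ (L n : ℕ) (q : Fin n → Fin 4 × Fin 4) (x : Fin n → (Fin 4 → ℤ)) (R : ℕ), (∀ i, (q i).1 < (q i).2) →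
      1 ≤ R → (R : ℝ) * a β ≤ ℓ₄ → 4 * R + 8 ≤ L →
      (∀ i j : Fin n, i ≠ j → ∃ k : Fin 4,
        (2 * (R : ℤ) + 4) ≤ |((((x i k - x j k : ℤ) : ZMod (2 * L + 1))).valMinAbs : ℤ)|) →
      |torusE G r β L (fun U => ∏ i, (plane G r (q i) (x i) U - torusE G r β L (plane G r (q i) (x i))))| ≤
        (C / (R : ℝ) ^ 4) ^ n

end PlaneResolved

/-- **Statement of `stub_fcp6`** — `stub_fcp` with the plane-resolved boundary law: for a pinned unit map the
periodic femto packages upgrade to `FBL6 ∧ FC2 ∧ FC3` (engine-grade, exactly as `Statement.stub_fcp`). -/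
def Statement.stub_fcp6 : Prop :=
  ∀ (G : Type) [Group G] [TopologicalSpace G] [IsTopologicalGroup G] [CompactSpace G]
    [MeasurableSpace G] [BorelSpace G], IsCompactSimpleLieGroup G →
    ∀ (r : LatticeRep G) (a : ℝ → ℝ), TwoPointPinned G r a → Skewness G r a →
      FBL6 G r a ∧ FC2 G r a ∧ FC3 G r a

/-- **Statement of `stub_collar6`** — the collar transfer for plane strings: `FBL6 ⇒ MomentBounds6` (torus DLR
for the union of the radius-`R+1` cubes, factorisation of the kernel over non-adjacent cubes, `FBL6` inside each
cube; the landed proof of `Statement.stub_collar` is generic in the observable). -/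
def Statement.stub_collar6 : Prop :=
  ∀ (G : Type) [Group G] [TopologicalSpace G] [IsTopologicalGroup G] [CompactSpace G]
    [MeasurableSpace G] [BorelSpace G] (r : LatticeRep G) (a : ℝ → ℝ), FBL6 G r a → MomentBounds6 G r a

/-- **Statement of `stub_assembly6`** — `stub_assembly` fed with the plane-resolved collar output: the soft OS
legs `PreOS` from `MomentBounds6`, `LowerBounds`, `GapInUnits` (limit on `⁰𝒮` by compactness + the a-uniform
E0′ bound; E0, E0′, E3, translations, coordinate permutations inherited; E2, hermiticity and signed permutations
from the exact plane-family reflection identities + equicontinuity; E4 and the mass gap by the reflection-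
positivity rope on genuine squares anchored by `GapInUnits`; non-triviality from `LowerBounds`). -/
def Statement.stub_assembly6 : Prop :=
  ∀ (G : Type) [Group G] [TopologicalSpace G] [IsTopologicalGroup G] [CompactSpace G]
    [MeasurableSpace G] [BorelSpace G] (r : LatticeRep G) (a : ℝ → ℝ),
    (∀ β, 0 < a β) → Filter.Tendsto a Filter.atTop (nhds 0) →
      MomentBounds6 G r a → LowerBounds G r a → GapInUnits G r a → PreOS G r a

end Summit.QuantumFields.YangMills.Cruxes.OSLegsFromFemtoAndGap.DlrCollarTransfer

end
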